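import Literature.Geometry.Lorentzian.IsometryProofs
import Literature.Topology.FourManifolds.SmoothOrientationProd
import Mathlib.Geometry.Manifold.ContMDiffMFDeriv
import HarnessLib

/-!
# The `t`-derivative of the slices of a field of bilinear forms on `N × ℝ`

For a manifold `N` (model with corners `I'` on the normed space `E'`) and a smooth field `s` of
bilinear forms on the tangent spaces of the cylinder `N × ℝ` (a smooth section of
`Hom(T(N × ℝ), Hom(T(N × ℝ), ℝ))`), the `t`-derivative at `t = t₀` of the tangential blocks of
the slices, `ṡ_{t₀}(z)(v, w) := d/dt|_{t₀} s_{(z,t)}((v,0),(w,0))`, is a smooth field of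
bilinear forms on `TN` (`exists_sliceDeriv_contMDiff`). This is the variation `ġ_t` of the
induced metrics of the level hypersurfaces of a metric in normal (Fermi) coordinates,
`g = g_t + dt²`, used in [BarHanke2023, §3.1, (8)–(9)] (`ġ_0 = -2·II`).

Proof: in the tangent trivialization of `N × ℝ` at `(x₀, t₀)` — which over the chart domain of
`x₀` splits as `τ_{x₀} ⊕ id` (`tangentCoordChange_prod`) and is the identity along `{x₀} × ℝ` —
the field reads as a smooth map `Ŝ : N × ℝ → Bil(E' × ℝ)` (`contMDiffAt_bilin_iff`); its partial
`t`-derivative is smooth in the parameter (`ContMDiffAt.mfderiv`), and it is the coordinate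
expression of `ṡ_{t₀}` in the trivialization of `TN` at `x₀`.

## References

* C. Bär, B. Hanke, *Boundary conditions for scalar curvature*, in: Perspectives in scalar
  curvature, Vol. 2, World Scientific 2023, 325–377, §3.1. [BarHanke2023]
* B. O'Neill, *Semi-Riemannian geometry*, Academic Press 1983, Ch. 4, pp. 104–108 (variation of
  the induced metric along a hypersurface family). [ONeill1983]
-/

set_option maxSynthPendingDepth 3 -- nested spaces of bilinear forms `Bil(E' × ℝ) →L Bil(E')`

noncomputable section

open Bundle Set Function Filter
open scoped Manifold ContDiff Topology

namespace Literature.Geometry.Riemannian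

open Literature.Geometry.Lorentzian Literature.Topology.FourManifolds

variable {E' : Type*} [NormedAddCommGroup E'] [NormedSpace ℝ E'] {H' : Type*} [TopologicalSpace H']
  {I' : ModelWithCorners ℝ E' H'} {N : Type*} [TopologicalSpace N] [ChartedSpace H' N]
  [IsManifold I' ∞ N]

/-! ### The tangent trivializations of `N` and of the cylinder at their base points -/

set_option backward.isDefEq.respectTransparency false in
/-- The inverse tangent trivialization of `N` at `x`, evaluated over `x` itself, is the identity.
[folklore] -/
theorem symmL_trivializationAt_self_apply (x : N) (u : E') :
    (trivializationAt E' (TangentSpace I' : N → Type _) x).symmL ℝ x u = u := by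
  rw [TangentBundle.symmL_trivializationAt_eq_core (mem_chart_source H' x)]
  exact (tangentBundleCore I' N).coordChange_self (achart H' x) x (mem_chart_source H' x) u

set_option backward.isDefEq.respectTransparency false in
/-- The tangent trivialization of `N` at `x`, evaluated over `x` itself, is the identity.
[folklore] -/
theorem continuousLinearMapAt_trivializationAt_self_apply (x : N) (u : TangentSpace I' x) :
    (trivializationAt E' (TangentSpace I' : N → Type _) x).continuousLinearMapAt ℝ x u = u := by
  rw [TangentBundle.continuousLinearMapAt_trivializationAt_eq_core (mem_chart_source H' x)]
  exact (tangentBundleCore I' N).coordChange_self (achart H' x) x (mem_chart_source H' x) u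

set_option backward.isDefEq.respectTransparency false in
/-- **Tangent trivializations of the cylinder split.** On `N × ℝ`, the inverse tangent
trivialization based at `(x₀, t₁)`, evaluated over a point `(x, t)` with `x` in the chart domain
of `x₀`, is `τ_{x₀}⁻¹(x) ⊕ id_ℝ` (`tangentCoordChange_prod`; the `ℝ`-factor is a model space).
[folklore] -/
theorem symmL_trivializationAt_prod (x₀ : N) (t₁ : ℝ) {x : N}
    (hx : x ∈ (chartAt H' x₀).source) (t : ℝ) :
    (trivializationAt (E' × ℝ) (TangentSpace (I'.prod 𝓘(ℝ, ℝ)) : N × ℝ → Type _)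
        ((x₀, t₁) : N × ℝ)).symmL ℝ ((x, t) : N × ℝ) =
      ((trivializationAt E' (TangentSpace I' : N → Type _) x₀).symmL ℝ x).prodMap
        (ContinuousLinearMap.id ℝ ℝ) := by
  have hmem : ((x, t) : N × ℝ) ∈ (chartAt (ModelProd H' ℝ) ((x₀, t₁) : N × ℝ)).source := by
    rw [prodChartedSpace_chartAt, OpenPartialHomeomorph.prod_source]
    exact ⟨hx, by simp⟩
  rw [TangentBundle.symmL_trivializationAt_eq_core hmem,
    TangentBundle.symmL_trivializationAt_eq_core hx]
  change tangentCoordChange (I'.prod 𝓘(ℝ, ℝ)) ((x₀, t₁) : N × ℝ) (x, t) (x, t) =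
    (tangentCoordChange I' x₀ x x).prodMap _
  rw [tangentCoordChange_prod ⟨by rwa [extChartAt_source], mem_extChartAt_source _⟩]
  congr 1
  exact tangentBundleCore_coordChange_model_space (I := 𝓘(ℝ, ℝ)) _ _ _

set_option backward.isDefEq.respectTransparency false in
/-- Pointwise form of `symmL_trivializationAt_prod`. [folklore] -/
theorem symmL_trivializationAt_prod_apply (x₀ : N) (t₁ : ℝ) {x : N}
    (hx : x ∈ (chartAt H' x₀).source) (t : ℝ) (u : E' × ℝ) :
    (trivializationAt (E' × ℝ) (TangentSpace (I'.prod 𝓘(ℝ, ℝ)) : N × ℝ → Type _)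
        ((x₀, t₁) : N × ℝ)).symmL ℝ ((x, t) : N × ℝ) u =
      ((((trivializationAt E' (TangentSpace I' : N → Type _) x₀).symmL ℝ x u.1 : E'), u.2) :
        E' × ℝ) := by
  rw [symmL_trivializationAt_prod x₀ t₁ hx t]
  rfl

set_option backward.isDefEq.respectTransparency false in
/-- Along the line `{z} × ℝ` the inverse tangent trivialization of the cylinder based at
`(z, t₁)` is the identity. [folklore] -/
theorem symmL_trivializationAt_cyl_apply (z : N) (t₁ t : ℝ) (u : E' × ℝ) :
    (trivializationAt (E' × ℝ) (TangentSpace (I'.prod 𝓘(ℝ, ℝ)) : N × ℝ → Type _)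
      ((z, t₁) : N × ℝ)).symmL ℝ ((z, t) : N × ℝ) u = u := by
  rw [symmL_trivializationAt_prod_apply z t₁ (mem_chart_source H' z) t,
    symmL_trivializationAt_self_apply]

/-- The tangent trivializations of the cylinder based at `(z, t₁)` and at `(z, t₂)` coincide (the
charts of `N × ℝ` are `chart × id`). [folklore] -/
theorem trivializationAt_cyl_eq (z : N) (t₁ t₂ : ℝ) :
    trivializationAt (E' × ℝ) (TangentSpace (I'.prod 𝓘(ℝ, ℝ)) : N × ℝ → Type _) ((z, t₁) : N × ℝ) =
      trivializationAt (E' × ℝ) (TangentSpace (I'.prod 𝓘(ℝ, ℝ)) : N × ℝ → Type _)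
        ((z, t₂) : N × ℝ) := rfl

/-! ### The slices -/

set_option backward.isDefEq.respectTransparency false in
/-- **The slices of a smooth field of bilinear forms on `T(N × ℝ)` are smooth in `t`.** For a
smooth section `s` of `Hom(T(N × ℝ), Hom(T(N × ℝ), ℝ))` there are smooth curves
`σ z : ℝ → Bil(E' × ℝ)` (`z : N`) with `σ z t = s_{(z,t)}` read in the model fibre (the tangent
trivialization of the cylinder at `(z, t)`, which is the identity over the line `{z} × ℝ`).
[folklore] -/
theorem exists_slice
    (s : Π p : N × ℝ, TangentSpace (I'.prod 𝓘(ℝ, ℝ)) p →L[ℝ]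
      TangentSpace (I'.prod 𝓘(ℝ, ℝ)) p →L[ℝ] ℝ)
    (hs : ContMDiff (I'.prod 𝓘(ℝ, ℝ)) ((I'.prod 𝓘(ℝ, ℝ)).prod
      𝓘(ℝ, (E' × ℝ) →L[ℝ] (E' × ℝ) →L[ℝ] ℝ)) ∞
      (fun p : N × ℝ ↦ TotalSpace.mk' ((E' × ℝ) →L[ℝ] (E' × ℝ) →L[ℝ] ℝ)
        (E := fun p : N × ℝ ↦ TangentSpace (I'.prod 𝓘(ℝ, ℝ)) p →L[ℝ]
          TangentSpace (I'.prod 𝓘(ℝ, ℝ)) p →L[ℝ] ℝ) p (s p))) :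
    ∃ σ : N → ℝ → (E' × ℝ) →L[ℝ] (E' × ℝ) →L[ℝ] ℝ,
      (∀ (z : N) (t : ℝ) (p q : E' × ℝ), σ z t p q = s (z, t) p q) ∧
      ∀ z : N, ContDiff ℝ ∞ (σ z) := by
  refine ⟨fun z t ↦
    (ContinuousLinearMap.precomp ℝ ((trivializationAt (E' × ℝ)
      (TangentSpace (I'.prod 𝓘(ℝ, ℝ)) : N × ℝ → Type _) ((z, t) : N × ℝ)).symmL ℝ
        ((z, t) : N × ℝ))).comp ((s (z, t)).comp ((trivializationAt (E' × ℝ)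
      (TangentSpace (I'.prod 𝓘(ℝ, ℝ)) : N × ℝ → Type _) ((z, t) : N × ℝ)).symmL ℝ
        ((z, t) : N × ℝ))), fun z t p q ↦ ?_, fun z ↦ ?_⟩
  · simp only [ContinuousLinearMap.coe_comp, Function.comp_apply,
      ContinuousLinearMap.precomp_apply]
    rw [symmL_trivializationAt_cyl_apply, symmL_trivializationAt_cyl_apply]
  · rw [← contMDiff_iff_contDiff]
    intro t
    have h := ((contMDiffAt_bilin_iff (IX := I'.prod 𝓘(ℝ, ℝ)) (IB := I'.prod 𝓘(ℝ, ℝ))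
      (V := (TangentSpace (I'.prod 𝓘(ℝ, ℝ)) : N × ℝ → Type _)) (b := fun p ↦ p) (s := s)
      (x₀ := (z, t))).1 (hs (z, t))).2
    have hc : ContMDiffAt 𝓘(ℝ, ℝ) (I'.prod 𝓘(ℝ, ℝ)) ∞ (fun t' : ℝ ↦ ((z, t') : N × ℝ)) t :=
      contMDiffAt_const.prodMk contMDiffAt_id
    exact h.comp t hc

/-! ### The slice derivative -/

set_option backward.isDefEq.respectTransparency false in
/-- **The slice derivative.** For a smooth field `s` of bilinear forms on `T(N × ℝ)` and
`t₀ : ℝ`, there is a smooth field `D` of bilinear forms on `TN` with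
`D_z(v, w) = d/dt|_{t₀} s_{(z,t)}((v,0),(w,0))` (the derivative at `t₀` of the `E'`-block of the
smooth curve `t ↦ s_{(z,t)}` in the normed space of bilinear forms on `E' × ℝ`).
[cite: BarHanke2023, §3.1, (8)–(9)] [folklore] -/
theorem exists_sliceDeriv_contMDiff
    (s : Π p : N × ℝ, TangentSpace (I'.prod 𝓘(ℝ, ℝ)) p →L[ℝ]
      TangentSpace (I'.prod 𝓘(ℝ, ℝ)) p →L[ℝ] ℝ)
    (hs : ContMDiff (I'.prod 𝓘(ℝ, ℝ)) ((I'.prod 𝓘(ℝ, ℝ)).prod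
      𝓘(ℝ, (E' × ℝ) →L[ℝ] (E' × ℝ) →L[ℝ] ℝ)) ∞
      (fun p : N × ℝ ↦ TotalSpace.mk' ((E' × ℝ) →L[ℝ] (E' × ℝ) →L[ℝ] ℝ)
        (E := fun p : N × ℝ ↦ TangentSpace (I'.prod 𝓘(ℝ, ℝ)) p →L[ℝ]
          TangentSpace (I'.prod 𝓘(ℝ, ℝ)) p →L[ℝ] ℝ) p (s p)))
    (t₀ : ℝ) :
    ∃ D : Π z : N, TangentSpace I' z →L[ℝ] TangentSpace I' z →L[ℝ] ℝ,
      ContMDiff I' (I'.prod 𝓘(ℝ, E' →L[ℝ] E' →L[ℝ] ℝ)) ∞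
        (fun z : N ↦ TotalSpace.mk' (E' →L[ℝ] E' →L[ℝ] ℝ)
          (E := fun z : N ↦ TangentSpace I' z →L[ℝ] TangentSpace I' z →L[ℝ] ℝ) z (D z)) ∧
      ∀ (z : N) (v w : E'),
        HasDerivAt (fun t : ℝ ↦ s (z, t) ((v, 0) : TangentSpace (I'.prod 𝓘(ℝ, ℝ)) (z, t))
          ((w, 0) : TangentSpace (I'.prod 𝓘(ℝ, ℝ)) (z, t))) (D z v w) t₀ := by
  obtain ⟨σ, hσv, hσs⟩ := exists_slice s hs
  obtain ⟨σ', hσd⟩ : ∃ σ' : N → (E' × ℝ) →L[ℝ] (E' × ℝ) →L[ℝ] ℝ,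
      ∀ z : N, HasDerivAt (σ z) (σ' z) t₀ :=
    ⟨_, fun z ↦ (((hσs z).differentiable (by simp)) t₀).hasFDerivAt.hasDerivAt⟩
  -- the `E'`-block `blk : Bil(E' × ℝ) →L Bil(E')`, `blk A (v, w) = A (v, 0) (w, 0)`
  obtain ⟨blk, hblk⟩ : ∃ blk : ((E' × ℝ) →L[ℝ] (E' × ℝ) →L[ℝ] ℝ) →L[ℝ] (E' →L[ℝ] E' →L[ℝ] ℝ),
      ∀ (A : (E' × ℝ) →L[ℝ] (E' × ℝ) →L[ℝ] ℝ) (v w : E'), blk A v w = A (v, 0) (w, 0) :=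
    ⟨(ContinuousLinearMap.postcomp E'
        (ContinuousLinearMap.precomp ℝ (ContinuousLinearMap.inl ℝ E' ℝ))).comp
        (ContinuousLinearMap.precomp ((E' × ℝ) →L[ℝ] ℝ) (ContinuousLinearMap.inl ℝ E' ℝ)),
      fun A v w ↦ rfl⟩
  -- the (identity) tangent trivializations of `N` at the base points, `J z : T_z N →L E'`
  obtain ⟨J, hJ⟩ : ∃ J : Π z : N, TangentSpace I' z →L[ℝ] E', ∀ (z : N) (u : TangentSpace I' z),
      J z u = u :=
    ⟨fun z ↦ (trivializationAt E' (TangentSpace I' : N → Type _) z).continuousLinearMapAt ℝ z,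
      continuousLinearMapAt_trivializationAt_self_apply⟩
  -- `D z := blk (σ z)'(t₀)`, transported to `T_z N` by `J z`
  refine ⟨fun z ↦ (ContinuousLinearMap.precomp ℝ (J z)).comp ((blk (σ' z)).comp (J z)), ?_, ?_⟩
  · intro x₀
    rw [contMDiffAt_bilin_iff]
    refine ⟨contMDiffAt_id, ?_⟩
    -- `Sh`: the field `s` read in the tangent trivialization of the cylinder at `(x₀, t₀)`
    obtain ⟨Sh, hShv, hShs⟩ : ∃ Sh : N × ℝ → (E' × ℝ) →L[ℝ] (E' × ℝ) →L[ℝ] ℝ,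
        (∀ (p : N × ℝ) (u u' : E' × ℝ), Sh p u u' =
          s p ((trivializationAt (E' × ℝ) (TangentSpace (I'.prod 𝓘(ℝ, ℝ)) : N × ℝ → Type _)
            ((x₀, t₀) : N × ℝ)).symmL ℝ p u) ((trivializationAt (E' × ℝ)
              (TangentSpace (I'.prod 𝓘(ℝ, ℝ)) : N × ℝ → Type _) ((x₀, t₀) : N × ℝ)).symmL ℝ p u')) ∧
        ContMDiffAt (I'.prod 𝓘(ℝ, ℝ)) 𝓘(ℝ, (E' × ℝ) →L[ℝ] (E' × ℝ) →L[ℝ] ℝ) ∞ Sh (x₀, t₀) :=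
      ⟨fun p ↦ (ContinuousLinearMap.precomp ℝ ((trivializationAt (E' × ℝ)
          (TangentSpace (I'.prod 𝓘(ℝ, ℝ)) : N × ℝ → Type _) ((x₀, t₀) : N × ℝ)).symmL ℝ p)).comp
          ((s p).comp ((trivializationAt (E' × ℝ)
            (TangentSpace (I'.prod 𝓘(ℝ, ℝ)) : N × ℝ → Type _) ((x₀, t₀) : N × ℝ)).symmL ℝ p)),
        fun p u u' ↦ rfl,
        ((contMDiffAt_bilin_iff (IX := I'.prod 𝓘(ℝ, ℝ)) (IB := I'.prod 𝓘(ℝ, ℝ))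
          (V := (TangentSpace (I'.prod 𝓘(ℝ, ℝ)) : N × ℝ → Type _)) (b := fun p ↦ p) (s := s)
          (x₀ := (x₀, t₀))).1 (hs (x₀, t₀))).2⟩
    -- its partial `t`-derivative at `t₀` (applied to `1`) is smooth in `x` at `x₀`
    have hΦ := ContMDiffAt.mfderiv_apply (I := 𝓘(ℝ, ℝ))
      (I' := 𝓘(ℝ, (E' × ℝ) →L[ℝ] (E' × ℝ) →L[ℝ] ℝ)) (J' := I') (n := ∞) (m := ∞)
      (fun (x : N) (t : ℝ) ↦ Sh (x, t)) (fun _ : N ↦ t₀) (fun x : N ↦ x) (fun _ : N ↦ (1 : ℝ))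
      (x₀ := x₀) hShs contMDiffAt_const contMDiffAt_id contMDiffAt_const le_rfl
    rw [inTangentCoordinates_model_space] at hΦ
    refine (blk.contDiff.contMDiff.contMDiffAt.comp x₀ hΦ).congr_of_eventuallyEq ?_
    filter_upwards [(chartAt H' x₀).open_source.mem_nhds (mem_chart_source H' x₀)] with x hx
    rw [Function.comp_apply]
    -- at `x` in the chart domain of `x₀`: `C := τ_{x₀}⁻¹(x)`, read as a map `E' →L E'` via `J x`
    obtain ⟨C, hC⟩ : ∃ C : E' →L[ℝ] E', ∀ u : E',
        C u = (trivializationAt E' (TangentSpace I' : N → Type _) x₀).symmL ℝ x u :=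
      ⟨(J x).comp ((trivializationAt E' (TangentSpace I' : N → Type _) x₀).symmL ℝ x),
        fun u ↦ by rw [ContinuousLinearMap.comp_apply, hJ]⟩
    -- conjugation by `C ⊕ id` on `Bil(E' × ℝ)`
    obtain ⟨L, hL⟩ : ∃ L : ((E' × ℝ) →L[ℝ] (E' × ℝ) →L[ℝ] ℝ) →L[ℝ] (E' × ℝ) →L[ℝ] (E' × ℝ) →L[ℝ] ℝ,
        ∀ (A : (E' × ℝ) →L[ℝ] (E' × ℝ) →L[ℝ] ℝ) (u u' : E' × ℝ),
          L A u u' = A (C u.1, u.2) (C u'.1, u'.2) :=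
      ⟨(ContinuousLinearMap.postcomp (E' × ℝ) (ContinuousLinearMap.precomp ℝ
          (C.prodMap (ContinuousLinearMap.id ℝ ℝ)))).comp
          (ContinuousLinearMap.precomp ((E' × ℝ) →L[ℝ] ℝ) (C.prodMap (ContinuousLinearMap.id ℝ ℝ))),
        fun A u u' ↦ rfl⟩
    -- along `{x} × ℝ`, `Sh = L ∘ σ x`
    have hShx : (fun t : ℝ ↦ Sh (x, t)) = L ∘ σ x := by
      funext t
      refine ContinuousLinearMap.ext fun u ↦ ContinuousLinearMap.ext fun u' ↦ ?_
      rw [hShv, Function.comp_apply, hL, hσv, symmL_trivializationAt_prod_apply x₀ t₀ hx t u,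
        symmL_trivializationAt_prod_apply x₀ t₀ hx t u', hC, hC]
    have hdSh := (L.hasFDerivAt.comp_hasDerivAt t₀ (hσd x)).hasFDerivAt.hasMFDerivAt
    rw [← hShx] at hdSh
    rw [hdSh.mfderiv, ContinuousLinearMap.toSpanSingleton_apply, one_smul]
    refine ContinuousLinearMap.ext fun v ↦ ContinuousLinearMap.ext fun w ↦ ?_
    simp only [ContinuousLinearMap.coe_comp, Function.comp_apply,
      ContinuousLinearMap.precomp_apply, hblk, hL, hJ, hC]
  · intro z v w
    have hev := ((ContinuousLinearMap.apply ℝ ℝ ((w, 0) : E' × ℝ)).comp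
      (ContinuousLinearMap.apply ℝ ((E' × ℝ) →L[ℝ] ℝ) ((v, 0) : E' × ℝ))).hasFDerivAt
        |>.comp_hasDerivAt t₀ (hσd z)
    have h1 : (fun t : ℝ ↦ s (z, t) ((v, 0) : TangentSpace (I'.prod 𝓘(ℝ, ℝ)) (z, t))
        ((w, 0) : TangentSpace (I'.prod 𝓘(ℝ, ℝ)) (z, t))) =
        ((ContinuousLinearMap.apply ℝ ℝ ((w, 0) : E' × ℝ)).comp
          (ContinuousLinearMap.apply ℝ ((E' × ℝ) →L[ℝ] ℝ) ((v, 0) : E' × ℝ))) ∘ σ z := by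
      funext t
      simp only [Function.comp_apply, ContinuousLinearMap.coe_comp,
        ContinuousLinearMap.apply_apply, hσv]
    rw [h1]
    refine hev.congr_deriv ?_
    simp only [ContinuousLinearMap.coe_comp, Function.comp_apply,
      ContinuousLinearMap.precomp_apply, ContinuousLinearMap.apply_apply, hblk, hJ]

end Literature.Geometry.Riemannian

end
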